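import Summits.CriticalPhenomena.PercolationContinuityZ3.Theorems.SahiMasterFamilyTerminalAll
import Summits.CriticalPhenomena.PercolationContinuityZ3.Theorems.SahiMasterFamilyCoordPoly

/-!
# (EQI-k) ⟺ non-vanishing of terminal families, every order

Unit `prim-master-conj` (crux anchor stmt-CriticalPhenomena-4575), gen 7.  Theorem R at every order (`SahiMasterFamilyTerminalAll`) with its
(T-a) hypothesis discharged by `sahiENonvanishing_of_common_pivotal_all` (`SahiMasterFamilyCoordPoly`): the identically-zero master conjecture
`MasterFamilyIdentEqIff (n+3)` is EQUIVALENT to "every terminal family of `n+3` increasing events (no zero-flag sub-family, no common pivotal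
coordinate, no private coordinate, all minors zero flags) has `E_{n+3}(μ_p) ≠ 0` for some interior `p`"
(`masterFamilyIdentEqIff_iff_terminal_all`).  Order 3: the tree's `sahiE3Nonvanishing_iff_terminal` (there the terminal class is the triangle
and the bowties, and the conjecture is a theorem, `masterFamilyIdentEqIff_three`); order `≥ 4`: open, with every coordinate of a terminal
family now pinned to `2 ≤ r_e ≤ k − 1` members.  No conjecture asserted; axioms standard. [this work]
-/

noncomputable section

open scoped Classical

namespace Summit.CriticalPhenomena.PercolationContinuityZ3.Theorems

open Finset Function
open Literature.Combinatorics.Sahi2008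
open Literature.Probability.LatticeModels.Kahn2022 (Affects)
open Literature.Probability.Percolation (DeterminedBy)
open Literature.Probability.Percolation.DecisionTree (ind)

/-- **(EQI-(n+3)) ⟺ terminal families of order `n+3` are non-vanishing.** [this work] -/
theorem masterFamilyIdentEqIff_iff_terminal_all (n : ℕ) :
    MasterFamilyIdentEqIff (n + 3) ↔
      ∀ (ι : Type) [Fintype ι] (U : Fin (n + 3) → Set (Set ι)) (S : Finset ι), (∀ j, IsUpperSet (U j)) →
        (∀ j, DeterminedBy (U j) (↑S : Set ι)) →
        (∀ m : Fin (n + 3), ¬ SuppZeroFlag (n + 2) (fun j => U (m.succAbove j))) →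
        (¬ ∃ e : ι, ∀ j, ∃ ω, e ∉ ω ∧ ω ∉ U j ∧ insert e ω ∈ U j) →
        (¬ ∃ e : ι, ∃ c : Fin (n + 3), (∃ ω, e ∉ ω ∧ ω ∉ U c ∧ insert e ω ∈ U c) ∧ ∀ j, j ≠ c → ¬ Affects (U j) e) →
        (∀ e ∈ S, ∀ b : Bool, SuppZeroFlag (n + 3) (fun j => secAt e b (U j))) →
          ∃ p : ι → unitInterval, (∀ i, (p i : ℝ) ∈ Set.Ioo (0 : ℝ) 1) ∧ sahiE (bernoulliWeight p) (n + 3) (fun j => ind (U j)) ≠ 0 := by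
  constructor
  · intro hI ι _ U S hU _ hno _ _ _
    exact (masterFamilyIdentEqIff_iff_nonvanishing n).1 hI ι U hU hno
  · intro hterm
    exact masterFamilyIdentEqIff_of_terminal_all n
      (fun _ _ U hU e he => sahiENonvanishing_of_common_pivotal_all U hU e he) hterm

/-- **(T_{n+3}) from terminal families alone** (Theorem R with (T-a) discharged). [this work] -/
theorem nonvanishing_of_terminal_all' (n : ℕ)
    (hterm : ∀ (ι : Type) [Fintype ι] (U : Fin (n + 3) → Set (Set ι)) (S : Finset ι), (∀ j, IsUpperSet (U j)) →
      (∀ j, DeterminedBy (U j) (↑S : Set ι)) →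
      (∀ m : Fin (n + 3), ¬ SuppZeroFlag (n + 2) (fun j => U (m.succAbove j))) →
      (¬ ∃ e : ι, ∀ j, ∃ ω, e ∉ ω ∧ ω ∉ U j ∧ insert e ω ∈ U j) →
      (¬ ∃ e : ι, ∃ c : Fin (n + 3), (∃ ω, e ∉ ω ∧ ω ∉ U c ∧ insert e ω ∈ U c) ∧ ∀ j, j ≠ c → ¬ Affects (U j) e) →
      (∀ e ∈ S, ∀ b : Bool, SuppZeroFlag (n + 3) (fun j => secAt e b (U j))) →
        ∃ p : ι → unitInterval, (∀ i, (p i : ℝ) ∈ Set.Ioo (0 : ℝ) 1) ∧ sahiE (bernoulliWeight p) (n + 3) (fun j => ind (U j)) ≠ 0)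
    (ι : Type) [Fintype ι] (U : Fin (n + 3) → Set (Set ι)) (hU : ∀ j, IsUpperSet (U j))
    (hno : ∀ m : Fin (n + 3), ¬ SuppZeroFlag (n + 2) (fun j => U (m.succAbove j))) :
    ∃ p : ι → unitInterval, (∀ i, (p i : ℝ) ∈ Set.Ioo (0 : ℝ) 1) ∧ sahiE (bernoulliWeight p) (n + 3) (fun j => ind (U j)) ≠ 0 :=
  nonvanishing_of_terminal_all n (fun _ _ U hU e he => sahiENonvanishing_of_common_pivotal_all U hU e he) hterm ι U hU hno

end Summit.CriticalPhenomena.PercolationContinuityZ3.Theorems
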